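import Mathlib
import HarnessLib
import Literature.Analysis.FluidPDE.TypeIAncientMildRescale
import Literature.Barriers.NavierStokesRegularity.AxisymmetricTypeIExclusionProofs
import Summits.NavierStokesRegularity.NavierStokesRegularity.Theorems.PoloidalWindowDoorPoloidalWindowRigidityNearIdentityDefs
import Summits.NavierStokesRegularity.NavierStokesRegularity.Theorems.PoloidalWindowDoorPoloidalWindowRigidityWindow
import Summits.NavierStokesRegularity.NavierStokesRegularity.Theorems.PoloidalWindowDoorPoloidalWindowRigidityStrata
import Summits.NavierStokesRegularity.NavierStokesRegularity.Theorems.PoloidalWindowDoorPoloidalWindowRigidityHotHullSlabUniform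
import Summits.NavierStokesRegularity.NavierStokesRegularity.Theorems.PoloidalWindowDoorPoloidalWindowRigidityLeastPinAnisotropicGap
import Summits.NavierStokesRegularity.NavierStokesRegularity.Theorems.SqueezeCycleExtremalElementExistsExtraction

/-!
# Route `PoloidalWindowDoor`, crux `PoloidalWindowRigidity` (K2, stmt-NavierStokesRegularity-19708) — THICK column, LINE 28 «near_one» (ns-idea-8):
# THE NEAR-ONE FLOOR WITHOUT SPATIAL DECAY and THE SCALING SYMMETRY GROUP OF A PINNED PROFILE — the sorry-free kernels §26–§28, PORTED

Seat ns-poloidal-K2-p2 g15 (DIRECTOR-NS #306, idea-crit-7's errand R2: LINES ≥ 30 import this instead of carrying the text; `--supports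
stmt-NavierStokesRegularity-19708 --as helper`).  Source: `Cruxes/PoloidalWindowRigidity/Lines/near_identity.lean` 63c9d39e624d §26–§28 (= `near_one.lean` §26–§28),
statements and proofs VERBATIM except: the objects `IsDss` / `IsDssAbout` come from `…NearIdentityDefs`; the Cruxes-local `Pinned C v` is UNFOLDED VERBATIM (nine
clauses); the hypothesis `hAG : AnisotropicGap` of `nearOne_pinned` / `scalingGroup_trichotomy` is DISCHARGED by the landed U3a
(`…LeastPinAnisotropicGap.anisotropicGap`, p709185) through `pin_lower_bound`; `class_of_pinned` = `…Window.isTypeIAncientMild_of_class`; `absN_le_norm` =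
`abs_apply_two_le_norm` (Literature).

* §26 algebra of DSS factors: `isDssAbout_zero_iff`, `isDss_translate_of_isDssAbout`, `isDssAbout_of_isDss_translate`, `isDssAbout_iff_translate`, `isDss_one`,
  `IsDss.mul/.inv/.pow/.zpow`, `isDss_of_tendsto` (the factor set of one profile is closed in `(0,∞)`).
* §27 `scaleInvariant_of_limit` (limits along factors `λⱼ ↓ 1` are SELF-SIMILAR — Chae–Wolf's Step 2 in the mild Type-I class WITHOUT spatial decay, via integer
  powers of the factors and the class-uniform slab modulus `…HotHullSlabUniform.exists_uniform_slab_modulus`), `nearOne_anchor` (THE NEAR-ONE FLOOR, anchored form: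
  no class-`C` profile with `‖v(−1,x₀)‖ ≥ a`, `‖x₀‖ ≤ A` is `λ`-DSS with `1 < λ < λ_*(C, A, a)` — the statement just outside
  `Literature.Barriers.NavierStokesRegularity.NearOneDssTypeIExclusion`, decay-free), `pin_lower_bound`, `nearOne_pinned` (pinned form, any centre in a ball),
  `not_selfSimilar_pinned`.
* §28 `scalingGroup_trichotomy`: the scaling symmetry group of a pinned profile about any centre `‖c‖ ≤ B` is TRIVIAL or CYCLIC with least factor `≥ λ_*(C, B)`.

WHAT THIS IS NOT: not a claim about Navier–Stokes regularity — ported supports of a files-only line (bears_on LADDER-NS N0, rung N0-LocalTubeDoorPoloidal); LINE 28/29's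
research cells, crux 19708 / item 20428, ⟨27893⟩ OPEN; NS regularity NOT proved.
-/

noncomputable section

-- the summit and its single sub-problem share the name (CONVENTIONS §1), as in every Theorems file
set_option linter.dupNamespace false

namespace Summit.NavierStokesRegularity.NavierStokesRegularity.Theorems.PoloidalWindowDoorPoloidalWindowRigidityNearOneFloor

open Set Function Filter Topology Metric
open scoped InnerProductSpace RealInnerProductSpace Laplacian NNReal
open Literature.Analysis Literature.Analysis.FluidPDE Literature.Analysis.UnboundedOperators
open Summit.NavierStokesRegularity.NavierStokesRegularity.Theorems
open PoloidalWindowDoorPoloidalWindowRigidityNearIdentityDefs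

/-! ## §26 The algebra of DSS factors (objects in `…NearIdentityDefs`) -/

/-- DSS about the origin `c = 0` is plain DSS. -/
theorem isDssAbout_zero_iff {lam : ℝ} {v : ℝ → EuclideanSpace ℝ (Fin 3) → EuclideanSpace ℝ (Fin 3)} : IsDssAbout 0 lam v ↔ IsDss lam v := by
  simp [IsDssAbout, IsDss]

/-- DSS about `c` is DSS about the origin for the translate `x ↦ v(t, x + c)`. -/
theorem isDss_translate_of_isDssAbout {c : EuclideanSpace ℝ (Fin 3)} {lam : ℝ} {v : ℝ → EuclideanSpace ℝ (Fin 3) → EuclideanSpace ℝ (Fin 3)}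
    (h : IsDssAbout c lam v) : IsDss lam (fun t x => v t (x + c)) := by
  intro t ht x
  show v t (x + c) = lam • v (lam ^ 2 * t) (lam • x + c)
  rw [h t ht (x + c), add_sub_cancel_right, add_comm]

/-- … and conversely. -/
theorem isDssAbout_of_isDss_translate {c : EuclideanSpace ℝ (Fin 3)} {lam : ℝ} {v : ℝ → EuclideanSpace ℝ (Fin 3) → EuclideanSpace ℝ (Fin 3)}
    (h : IsDss lam (fun t x => v t (x + c))) : IsDssAbout c lam v := by
  intro t ht x
  have key : v t (x - c + c) = lam • v (lam ^ 2 * t) (lam • (x - c) + c) := h t ht (x - c)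
  rw [sub_add_cancel] at key
  rw [key, add_comm]

/-- DSS about `c` ⇔ DSS about the origin for the translate `x ↦ v(t, x + c)`. -/
theorem isDssAbout_iff_translate {c : EuclideanSpace ℝ (Fin 3)} {lam : ℝ} {v : ℝ → EuclideanSpace ℝ (Fin 3) → EuclideanSpace ℝ (Fin 3)} :
    IsDssAbout c lam v ↔ IsDss lam (fun t x => v t (x + c)) :=
  ⟨isDss_translate_of_isDssAbout, isDssAbout_of_isDss_translate⟩

/-- Every profile is `1`-DSS (the identity). -/
theorem isDss_one (v : ℝ → EuclideanSpace ℝ (Fin 3) → EuclideanSpace ℝ (Fin 3)) : IsDss 1 v := fun t _ x => by simp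

/-- Factors compose: `lam`-DSS and `mu`-DSS ⇒ `(lam·mu)`-DSS. -/
theorem _root_.Summit.NavierStokesRegularity.NavierStokesRegularity.Theorems.PoloidalWindowDoorPoloidalWindowRigidityNearIdentityDefs.IsDss.mul {a b : ℝ} {v : ℝ → EuclideanSpace ℝ (Fin 3) → EuclideanSpace ℝ (Fin 3)} (hva : IsDss a v) (ha : 0 < a) (hvb : IsDss b v) :
    IsDss (a * b) v := by
  intro t ht x
  have hat : a ^ 2 * t < 0 := mul_neg_of_pos_of_neg (pow_pos ha 2) ht
  rw [hva t ht x, hvb (a ^ 2 * t) hat (a • x), smul_smul, smul_smul]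
  have e1 : b ^ 2 * (a ^ 2 * t) = (a * b) ^ 2 * t := by ring
  rw [e1, mul_comm b a]

/-- Factors invert: `lam`-DSS ⇒ `lam⁻¹`-DSS. -/
theorem _root_.Summit.NavierStokesRegularity.NavierStokesRegularity.Theorems.PoloidalWindowDoorPoloidalWindowRigidityNearIdentityDefs.IsDss.inv {a : ℝ} {v : ℝ → EuclideanSpace ℝ (Fin 3) → EuclideanSpace ℝ (Fin 3)} (hv : IsDss a v) (ha : 0 < a) : IsDss a⁻¹ v := by
  intro t ht x
  have hat : a⁻¹ ^ 2 * t < 0 := mul_neg_of_pos_of_neg (pow_pos (inv_pos.2 ha) 2) ht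
  have key := hv (a⁻¹ ^ 2 * t) hat (a⁻¹ • x)
  have e1 : a ^ 2 * (a⁻¹ ^ 2 * t) = t := by field_simp
  rw [e1, smul_smul, mul_inv_cancel₀ ha.ne', one_smul] at key
  rw [key, smul_smul, inv_mul_cancel₀ ha.ne', one_smul]

/-- Natural powers of a factor are factors (Pineau–Vicol 2026, footnote 8). -/
theorem _root_.Summit.NavierStokesRegularity.NavierStokesRegularity.Theorems.PoloidalWindowDoorPoloidalWindowRigidityNearIdentityDefs.IsDss.pow {a : ℝ} {v : ℝ → EuclideanSpace ℝ (Fin 3) → EuclideanSpace ℝ (Fin 3)} (hv : IsDss a v) (ha : 0 < a) : ∀ k : ℕ, IsDss (a ^ k) v := by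
  intro k
  induction k with
  | zero => simpa using isDss_one v
  | succ k ih =>
      rw [pow_succ]
      exact ih.mul (pow_pos ha k) hv

/-- Integer powers of a factor are factors. -/
theorem _root_.Summit.NavierStokesRegularity.NavierStokesRegularity.Theorems.PoloidalWindowDoorPoloidalWindowRigidityNearIdentityDefs.IsDss.zpow {a : ℝ} {v : ℝ → EuclideanSpace ℝ (Fin 3) → EuclideanSpace ℝ (Fin 3)} (hv : IsDss a v) (ha : 0 < a) : ∀ k : ℤ, IsDss (a ^ k) v
  | (n : ℕ) => by
      rw [zpow_natCast]
      exact hv.pow ha n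
  | Int.negSucc n => by
      rw [zpow_negSucc]
      exact (hv.pow ha (n + 1)).inv (pow_pos ha _)

/-- **The factor set of ONE profile is closed in `(0,∞)`** (joint continuity on the open slab only). -/
theorem isDss_of_tendsto {v : ℝ → EuclideanSpace ℝ (Fin 3) → EuclideanSpace ℝ (Fin 3)}
    (hcont : ContinuousOn (Function.uncurry v) (Set.Iio (0 : ℝ) ×ˢ Set.univ)) {c : ℕ → ℝ} {c₀ : ℝ} (hc₀ : 0 < c₀)
    (hlim : Tendsto c atTop (𝓝 c₀)) (hd : ∀ n, IsDss (c n) v) : IsDss c₀ v := by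
  intro t ht x
  have hpt : ContinuousAt (Function.uncurry v) (c₀ ^ 2 * t, c₀ • x) :=
    hcont.continuousAt ((isOpen_Iio.prod isOpen_univ).mem_nhds
      (Set.mem_prod.2 ⟨mul_neg_of_pos_of_neg (pow_pos hc₀ 2) ht, Set.mem_univ _⟩))
  have h1 : Tendsto (fun n => ((c n) ^ 2 * t, c n • x)) atTop (𝓝 (c₀ ^ 2 * t, c₀ • x)) :=
    ((hlim.pow 2).mul_const t).prodMk_nhds (hlim.smul_const x)
  have h2 : Tendsto (fun n => v ((c n) ^ 2 * t) (c n • x)) atTop (𝓝 (v (c₀ ^ 2 * t) (c₀ • x))) := hpt.tendsto.comp h1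
  have h3 : Tendsto (fun n => c n • v ((c n) ^ 2 * t) (c n • x)) atTop (𝓝 (c₀ • v (c₀ ^ 2 * t) (c₀ • x))) := hlim.smul h2
  have h4 : (fun n => c n • v ((c n) ^ 2 * t) (c n • x)) = fun _ => v t x := funext fun n => (hd n t ht x).symm
  rw [h4, tendsto_const_nhds_iff] at h3
  exact h3

/-! ## §27 THE NEAR-ONE FLOOR WITHOUT SPATIAL DECAY (PROVED): Chae–Wolf's Step 2 in the mild Type-I class, the decay hypothesis (1.7)/(1.10) replaced by an … (abridged) -/

/-- **Limits along factors `λⱼ ↓ 1` are SELF-SIMILAR (PROVED).** If class-`C` profiles `vs j`, each `λⱼ`-DSS about the origin with `λⱼ > 1`, `λⱼ → 1`, … (abridged; full docstring in `Lines/near_one.lean`) -/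
theorem scaleInvariant_of_limit (C : ℝ) {vs : ℕ → ℝ → EuclideanSpace ℝ (Fin 3) → EuclideanSpace ℝ (Fin 3)}
    {U : ℝ → EuclideanSpace ℝ (Fin 3) → EuclideanSpace ℝ (Fin 3)} {lams : ℕ → ℝ}
    (hrate : ∀ j, HasTypeITimeDecay C (vs j)) (hcont : ∀ j, ContinuousOn (Function.uncurry (vs j)) (Set.Iio (0 : ℝ) ×ˢ Set.univ))
    (hmild : ∀ j, ∀ s t : ℝ, s < t → t < 0 → ∀ x, vs j t x =
      UnboundedOperators.heatExtension (vs j s) (t - s) x - oseenDuhamel 1 s (vs j) (vs j) t x)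
    (hdiv : ∀ j, ∀ t < 0, VectorCalculus.IsDivFree (vs j t))
    (hconv : ∀ t < 0, ∀ x, Tendsto (fun j => vs j t x) atTop (𝓝 (U t x)))
    (hdss : ∀ j, IsDss (lams j) (vs j)) (hgt : ∀ j, 1 < lams j) (hlim : Tendsto lams atTop (𝓝 1)) :
    ∀ mu : ℝ, 0 < mu → IsDss mu U := by
  classical
  have stepA : ∀ mu : ℝ, 1 ≤ mu → IsDss mu U := by
    intro mu hmu t ht x
    have hmu0 : 0 < mu := by linarith
    have hex : ∀ j, ∃ k : ℕ, mu < lams j ^ (k + 1) := fun j => by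
      obtain ⟨n, hn⟩ := pow_unbounded_of_one_lt mu (hgt j)
      exact ⟨n, hn.trans_le (pow_le_pow_right₀ (hgt j).le (Nat.le_succ n))⟩
    let k : ℕ → ℕ := fun j => Nat.find (hex j)
    have hk1 : ∀ j, mu < lams j ^ (k j + 1) := fun j => Nat.find_spec (hex j)
    have hk2 : ∀ j, lams j ^ (k j) ≤ mu := by
      intro j
      rcases Nat.eq_zero_or_pos (k j) with h0 | hpos
      · rw [h0, pow_zero]; exact hmu
      · have hmin : ¬ (mu < lams j ^ (k j - 1 + 1)) := Nat.find_min (hex j) (Nat.sub_lt hpos Nat.one_pos)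
        rw [Nat.sub_add_cancel hpos] at hmin
        exact not_lt.1 hmin
    set mus : ℕ → ℝ := fun j => lams j ^ (k j) with hmus
    have hl0 : ∀ j, 0 < lams j := fun j => by linarith [hgt j]
    have hmus_le : ∀ j, mus j ≤ mu := hk2
    have hmus_ge : ∀ j, mu / lams j ≤ mus j := by
      intro j
      rw [div_le_iff₀ (hl0 j)]
      have := hk1 j
      rw [pow_succ] at this
      exact this.le
    have hmus_lim : Tendsto mus atTop (𝓝 mu) := by
      have h1 : Tendsto (fun j => mu / lams j) atTop (𝓝 mu) := by
        have h := (tendsto_const_nhds (x := mu)).div hlim one_ne_zero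
        rw [div_one] at h
        exact h
      exact tendsto_of_tendsto_of_tendsto_of_le_of_le h1 tendsto_const_nhds hmus_ge hmus_le
    have hd : ∀ j, IsDss (mus j) (vs j) := fun j => (hdss j).pow (hl0 j) (k j)
    set T : ℝ := mu ^ 2 * t with hT
    have hT0 : T < 0 := mul_neg_of_pos_of_neg (pow_pos hmu0 2) ht
    set R : ℝ := max 1 (max (-T) (4 / (-T))) with hR
    have hR1 : 1 ≤ R := le_max_left _ _
    have hRT : -R ≤ T := by have := le_max_left (-T) (4 / (-T)); have := le_max_right 1 (max (-T) (4 / (-T))); linarith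
    have hRinv : T / 4 ≤ -R⁻¹ := by
      have h4 : 4 / (-T) ≤ R := (le_max_right _ _).trans (le_max_right _ _)
      have hR0 : 0 < R := by linarith
      have h5 : R⁻¹ ≤ (-T) / 4 := by
        rw [inv_le_comm₀ hR0 (by linarith), inv_div]
        exact h4
      linarith
    obtain ⟨M, hM0, hM⟩ := PoloidalWindowDoorPoloidalWindowRigidityHotHullSlabUniform.exists_uniform_slab_modulus C hR1
    have hTmem : T ∈ Set.Icc (-R) (-R⁻¹) := ⟨hRT, by linarith⟩
    have hev : ∀ᶠ j in atTop, mu / 2 < mus j := hmus_lim.eventually (lt_mem_nhds (by linarith))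
    have hmem : ∀ᶠ j in atTop, mus j ^ 2 * t ∈ Set.Icc (-R) (-R⁻¹) := by
      filter_upwards [hev] with j hj
      have hmj0 : 0 < mus j := by linarith
      have hsq_le : mus j ^ 2 ≤ mu ^ 2 := pow_le_pow_left₀ hmj0.le (hmus_le j) 2
      have hsq_ge : (mu / 2) ^ 2 ≤ mus j ^ 2 := pow_le_pow_left₀ (by linarith) hj.le 2
      constructor
      · nlinarith
      · nlinarith
    have hAB : Tendsto (fun j => vs j (mus j ^ 2 * t) (mus j • x) - vs j T (mu • x)) atTop (𝓝 0) := by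
      have hbound : ∀ᶠ j in atTop, ‖vs j (mus j ^ 2 * t) (mus j • x) - vs j T (mu • x)‖ ≤
          M * (|mus j ^ 2 * t - T| + ‖mus j • x - mu • x‖) := by
        filter_upwards [hmem] with j hj
        exact hM (hrate j) (hcont j) (hmild j) (hdiv j) _ hj _ hTmem _ _
      have hlim0 : Tendsto (fun j => M * (|mus j ^ 2 * t - T| + ‖mus j • x - mu • x‖)) atTop (𝓝 0) := by
        have h1 : Tendsto (fun j => mus j ^ 2 * t - T) atTop (𝓝 (mu ^ 2 * t - T)) := ((hmus_lim.pow 2).mul_const t).sub_const T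
        have h2 : Tendsto (fun j => mus j • x - mu • x) atTop (𝓝 (mu • x - mu • x)) := (hmus_lim.smul_const x).sub_const (mu • x)
        have h3 := (h1.abs.add h2.norm).const_mul M
        simpa [hT] using h3
      exact squeeze_zero_norm' hbound hlim0
    have hB : Tendsto (fun j => vs j T (mu • x)) atTop (𝓝 (U T (mu • x))) := hconv T hT0 (mu • x)
    have hA : Tendsto (fun j => vs j (mus j ^ 2 * t) (mus j • x)) atTop (𝓝 (U T (mu • x))) := by
      have h := hAB.add hB
      simp only [sub_add_cancel, zero_add] at h
      exact h
    have h5 : Tendsto (fun j => vs j t x) atTop (𝓝 (mu • U T (mu • x))) := by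
      have e : (fun j => vs j t x) = fun j => mus j • vs j (mus j ^ 2 * t) (mus j • x) := funext fun j => hd j t ht x
      rw [e]
      exact hmus_lim.smul hA
    exact tendsto_nhds_unique (hconv t ht x) h5
  intro mu hmu
  by_cases h1 : 1 ≤ mu
  · exact stepA mu h1
  · have hinv : 1 ≤ mu⁻¹ := (one_le_inv₀ hmu).2 (not_le.1 h1).le
    have := (stepA mu⁻¹ hinv).inv (inv_pos.2 hmu)
    rwa [inv_inv] at this

/-- **THE NEAR-ONE FLOOR, ANCHORED FORM (PROVED) — the statement just outside `Literature.Barriers.NavierStokesRegularity.NearOneDssTypeIExclusion`.** … (abridged; full docstring in `Lines/near_one.lean`) -/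
theorem nearOne_anchor (C A a : ℝ) (ha : 0 < a) :
    ∃ lamStar : ℝ, 1 < lamStar ∧ ∀ (v : ℝ → EuclideanSpace ℝ (Fin 3) → EuclideanSpace ℝ (Fin 3)) (lam : ℝ) (x₀ : EuclideanSpace ℝ (Fin 3)),
      HasTypeITimeDecay C v → ContinuousOn (Function.uncurry v) (Set.Iio (0 : ℝ) ×ˢ Set.univ) →
      (∀ s t : ℝ, s < t → t < 0 → ∀ x, v t x = UnboundedOperators.heatExtension (v s) (t - s) x - oseenDuhamel 1 s v v t x) →
      (∀ t < 0, VectorCalculus.IsDivFree (v t)) →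
      ‖x₀‖ ≤ A → a ≤ ‖v (-1) x₀‖ → 1 < lam → lam < lamStar → IsDss lam v → False := by
  by_contra hcon
  have hseq : ∀ n : ℕ, ∃ (v : ℝ → EuclideanSpace ℝ (Fin 3) → EuclideanSpace ℝ (Fin 3)) (lam : ℝ) (x₀ : EuclideanSpace ℝ (Fin 3)),
      HasTypeITimeDecay C v ∧ ContinuousOn (Function.uncurry v) (Set.Iio (0 : ℝ) ×ˢ Set.univ) ∧
      (∀ s t : ℝ, s < t → t < 0 → ∀ x, v t x = UnboundedOperators.heatExtension (v s) (t - s) x - oseenDuhamel 1 s v v t x) ∧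
      (∀ t < 0, VectorCalculus.IsDivFree (v t)) ∧
      ‖x₀‖ ≤ A ∧ a ≤ ‖v (-1) x₀‖ ∧ 1 < lam ∧ lam < 1 + 1 / ((n : ℝ) + 1) ∧ IsDss lam v := by
    intro n
    by_contra hn
    push Not at hn
    have hpos : (1 : ℝ) < 1 + 1 / ((n : ℝ) + 1) := by
      have : (0 : ℝ) < 1 / ((n : ℝ) + 1) := by positivity
      linarith
    exact hcon ⟨1 + 1 / ((n : ℝ) + 1), hpos, fun v lam x₀ h1 h2 h3 h4 h5 h6 h7 h8 h9 => hn v lam x₀ h1 h2 h3 h4 h5 h6 h7 h8 h9⟩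
  choose vs lams xs hrate hcont hmild hdiv hxs hanc hgt hlt hdss using hseq
  have hw : ∀ n, IsTypeIAncientMild C (vs n) := fun n =>
    PoloidalWindowDoorPoloidalWindowRigidityWindow.isTypeIAncientMild_of_class (hrate n) (hcont n) (hmild n) (hdiv n)
  obtain ⟨φ, hφ, W, hW, hpt, hfd, htlu, htlufd⟩ := exists_tendsto_of_isTypeIAncientMild_seq C hw
  obtain ⟨xinf, hxinf, ψ, hψ, hxlim⟩ :=
    (isCompact_closedBall (0 : EuclideanSpace ℝ (Fin 3)) A).tendsto_subseq (fun n => mem_closedBall_zero_iff.2 (hxs (φ n)))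
  have hrateW : HasTypeITimeDecay C W := hW.2.2.2
  have hcontW : ContinuousOn (Function.uncurry W) (Set.Iio (0 : ℝ) ×ˢ Set.univ) := hW.1.continuousOn
  have hmildW : ∀ s t : ℝ, s < t → t < 0 → ∀ x, W t x =
      UnboundedOperators.heatExtension (W s) (t - s) x - oseenDuhamel 1 s W W t x :=
    fun s t hst ht x => hW.mild_eq_heatExtension hst ht x
  have hdivW : ∀ t < 0, VectorCalculus.IsDivFree (W t) := hW.2.1
  have hsub : Tendsto (fun j => φ (ψ j)) atTop atTop := (hφ.comp hψ).tendsto_atTop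
  have hl1 : Tendsto (fun j => lams (φ (ψ j))) atTop (𝓝 1) := by
    have h0 : Tendsto (fun j => 1 + 1 / (((φ (ψ j) : ℕ) : ℝ) + 1)) atTop (𝓝 (1 + 0)) :=
      tendsto_const_nhds.add (tendsto_one_div_add_atTop_nhds_zero_nat.comp hsub)
    rw [add_zero] at h0
    exact tendsto_of_tendsto_of_tendsto_of_le_of_le tendsto_const_nhds h0 (fun j => (hgt _).le) (fun j => (hlt _).le)
  have hsc : ∀ mu : ℝ, 0 < mu → IsDss mu W :=
    scaleInvariant_of_limit C (vs := fun j => vs (φ (ψ j))) (lams := fun j => lams (φ (ψ j)))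
      (fun j => hrate _) (fun j => hcont _) (fun j => hmild _) (fun j => hdiv _)
      (fun t ht x => (hpt t ht x).comp hψ.tendsto_atTop) (fun j => hdss _) (fun j => hgt _) hl1
  have hW0 : ∀ t < 0, ∀ x, W t x = 0 :=
    PoloidalWindowDoorPoloidalWindowRigidityStrata.eq_zero_of_scaleInvariant hrateW hcontW hmildW hdivW
      (fun lam hlam s hs y => (hsc lam hlam s hs y).symm)
  obtain ⟨M, hM0, hM⟩ := PoloidalWindowDoorPoloidalWindowRigidityHotHullSlabUniform.exists_uniform_slab_modulus C (le_refl (1 : ℝ))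
  have hm1 : (-1 : ℝ) ∈ Set.Icc (-(1 : ℝ)) (-(1 : ℝ)⁻¹) := by norm_num
  have hdiff : Tendsto (fun j => vs (φ (ψ j)) (-1) (xs (φ (ψ j))) - vs (φ (ψ j)) (-1) xinf) atTop (𝓝 0) := by
    have hbound : ∀ j, ‖vs (φ (ψ j)) (-1) (xs (φ (ψ j))) - vs (φ (ψ j)) (-1) xinf‖ ≤ M * (|(-1 : ℝ) - (-1)| + ‖xs (φ (ψ j)) - xinf‖) :=
      fun j => hM (hrate _) (hcont _) (hmild _) (hdiv _) _ hm1 _ hm1 _ _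
    have hlim0 : Tendsto (fun j => M * (|(-1 : ℝ) - (-1)| + ‖xs (φ (ψ j)) - xinf‖)) atTop (𝓝 0) := by
      have h2 : Tendsto (fun j => xs (φ (ψ j)) - xinf) atTop (𝓝 (xinf - xinf)) := hxlim.sub_const xinf
      have h3 := (h2.norm).const_mul M
      simpa using h3
    exact squeeze_zero_norm' (Eventually.of_forall hbound) hlim0
  have hB : Tendsto (fun j => vs (φ (ψ j)) (-1) xinf) atTop (𝓝 (W (-1) xinf)) := (hpt (-1) (by norm_num) xinf).comp hψ.tendsto_atTop
  have hA : Tendsto (fun j => vs (φ (ψ j)) (-1) (xs (φ (ψ j)))) atTop (𝓝 (W (-1) xinf)) := by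
    have h := hdiff.add hB
    simp only [sub_add_cancel, zero_add] at h
    exact h
  have hge : a ≤ ‖W (-1) xinf‖ := ge_of_tendsto hA.norm (Eventually.of_forall fun j => hanc _)
  rw [hW0 (-1) (by norm_num) xinf, norm_zero] at hge
  exact absurd hge (not_le.2 ha)

/-! ### The pin is never shallow (LINE 24 §3, from the LANDED anisotropic gap U3a) -/

/-- **The pin is never shallow** (LINE 24 `pin_lower_bound`, here UNCONDITIONAL by the landed U3a `…LeastPinAnisotropicGap.anisotropicGap`): every pinned
class-`C` profile has `|N| = |v₂(−1,0)| ≥ δ(C) > 0`.  `Pinned` unfolded VERBATIM. -/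
theorem pin_lower_bound (C : ℝ) :
    ∃ δ : ℝ, 0 < δ ∧ ∀ v : ℝ → EuclideanSpace ℝ (Fin 3) → EuclideanSpace ℝ (Fin 3),
      (Literature.Analysis.FluidPDE.HasTypeITimeDecay C v ∧
        ContinuousOn (Function.uncurry v) (Set.Iio (0 : ℝ) ×ˢ Set.univ) ∧
        (∀ s t : ℝ, s < t → t < 0 → ∀ x, v t x =
          Literature.Analysis.UnboundedOperators.heatExtension (v s) (t - s) x -
            Literature.Analysis.FluidPDE.oseenDuhamel 1 s v v t x) ∧
        (∀ t < 0, Literature.Analysis.FluidPDE.VectorCalculus.IsDivFree (v t)) ∧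
        (∀ s < 0, ∀ q, ⟪Literature.Analysis.FluidPDE.curl (v s) q, EuclideanSpace.single 2 1⟫_ℝ = 0) ∧
        v (-1) 0 2 ≠ 0 ∧ (∀ t < 0, ∀ x, Real.sqrt (-t) * |v t x 2| ≤ |v (-1) 0 2|) ∧
        (∀ h : EuclideanSpace ℝ (Fin 3), fderiv ℝ (v (-1)) 0 h 2 = 0) ∧
        (deriv (fun s => v s 0 2) (-1) = v (-1) 0 2 / 2 ∧ v (-1) 0 2 * (Δ (fun q => v (-1) q 2)) 0 ≤ 0)) → δ ≤ |v (-1) 0 2| := by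
  obtain ⟨δ, hδ, hgap⟩ := PoloidalWindowDoorPoloidalWindowRigidityLeastPinAnisotropicGap.anisotropicGap C
  refine ⟨δ, hδ, fun v hP => ?_⟩
  by_contra hlt
  have hlt' : |v (-1) 0 2| < δ := lt_of_not_ge hlt
  have hcl := PoloidalWindowDoorPoloidalWindowRigidityWindow.isTypeIAncientMild_of_class hP.1 hP.2.1 hP.2.2.1 hP.2.2.2.1
  have hz := hgap v hcl hP.2.2.2.2.1 (fun t ht x => (hP.2.2.2.2.2.2.1 t ht x).trans hlt'.le)
  have h0 := hz (-1) (by norm_num) 0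
  exact hP.2.2.2.2.2.1 (by rw [h0]; rfl)

/-- **THE NEAR-ONE FLOOR FOR PINNED PROFILES, ANY CENTRE IN A BALL (PROVED from U3a by name):** for every `C` and `B` there is `λ_*(C, B) > 1` such that … (abridged; full docstring in `Lines/near_one.lean`) -/
theorem nearOne_pinned (C B : ℝ) :
    ∃ lamStar : ℝ, 1 < lamStar ∧ ∀ (v : ℝ → EuclideanSpace ℝ (Fin 3) → EuclideanSpace ℝ (Fin 3)) (lam : ℝ) (c : EuclideanSpace ℝ (Fin 3)),
      (Literature.Analysis.FluidPDE.HasTypeITimeDecay C v ∧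
        ContinuousOn (Function.uncurry v) (Set.Iio (0 : ℝ) ×ˢ Set.univ) ∧
        (∀ s t : ℝ, s < t → t < 0 → ∀ x, v t x =
          Literature.Analysis.UnboundedOperators.heatExtension (v s) (t - s) x -
            Literature.Analysis.FluidPDE.oseenDuhamel 1 s v v t x) ∧
        (∀ t < 0, Literature.Analysis.FluidPDE.VectorCalculus.IsDivFree (v t)) ∧
        (∀ s < 0, ∀ q, ⟪Literature.Analysis.FluidPDE.curl (v s) q, EuclideanSpace.single 2 1⟫_ℝ = 0) ∧
        v (-1) 0 2 ≠ 0 ∧ (∀ t < 0, ∀ x, Real.sqrt (-t) * |v t x 2| ≤ |v (-1) 0 2|) ∧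
        (∀ h : EuclideanSpace ℝ (Fin 3), fderiv ℝ (v (-1)) 0 h 2 = 0) ∧
        (deriv (fun s => v s 0 2) (-1) = v (-1) 0 2 / 2 ∧ v (-1) 0 2 * (Δ (fun q => v (-1) q 2)) 0 ≤ 0)) → ‖c‖ ≤ B → 1 < lam → lam < lamStar → IsDssAbout c lam v → False := by
  obtain ⟨δ, hδ, hpin⟩ := pin_lower_bound C
  obtain ⟨lamStar, h1, H⟩ := nearOne_anchor C B δ hδ
  refine ⟨lamStar, h1, fun v lam c hP hc hlam hlt hd => ?_⟩
  have hw : IsTypeIAncientMild C (fun t x => v t (x + c)) := (PoloidalWindowDoorPoloidalWindowRigidityWindow.isTypeIAncientMild_of_class hP.1 hP.2.1 hP.2.2.1 hP.2.2.2.1).comp_add_right c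
  refine H (fun t x => v t (x + c)) lam (-c) hw.2.2.2 hw.1.continuousOn (fun s t hst ht x => hw.mild_eq_heatExtension hst ht x) hw.2.1
    (by rwa [norm_neg]) ?_ hlam hlt (isDss_translate_of_isDssAbout hd)
  show δ ≤ ‖v (-1) (-c + c)‖
  rw [neg_add_cancel]
  exact (hpin v hP).trans (Literature.Barriers.NavierStokesRegularity.abs_apply_two_le_norm (v (-1) 0))

/-- **SELF-SIMILAR PINNED PROFILES DO NOT EXIST, ANY CENTRE (PROVED):** a pinned profile which is `λ`-DSS about `c` for EVERY `λ > 0` is absurd … (abridged; full docstring in `Lines/near_one.lean`) -/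
theorem not_selfSimilar_pinned {C : ℝ} {v : ℝ → EuclideanSpace ℝ (Fin 3) → EuclideanSpace ℝ (Fin 3)} {c : EuclideanSpace ℝ (Fin 3)}
    (hP : (Literature.Analysis.FluidPDE.HasTypeITimeDecay C v ∧
        ContinuousOn (Function.uncurry v) (Set.Iio (0 : ℝ) ×ˢ Set.univ) ∧
        (∀ s t : ℝ, s < t → t < 0 → ∀ x, v t x =
          Literature.Analysis.UnboundedOperators.heatExtension (v s) (t - s) x -
            Literature.Analysis.FluidPDE.oseenDuhamel 1 s v v t x) ∧
        (∀ t < 0, Literature.Analysis.FluidPDE.VectorCalculus.IsDivFree (v t)) ∧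
        (∀ s < 0, ∀ q, ⟪Literature.Analysis.FluidPDE.curl (v s) q, EuclideanSpace.single 2 1⟫_ℝ = 0) ∧
        v (-1) 0 2 ≠ 0 ∧ (∀ t < 0, ∀ x, Real.sqrt (-t) * |v t x 2| ≤ |v (-1) 0 2|) ∧
        (∀ h : EuclideanSpace ℝ (Fin 3), fderiv ℝ (v (-1)) 0 h 2 = 0) ∧
        (deriv (fun s => v s 0 2) (-1) = v (-1) 0 2 / 2 ∧ v (-1) 0 2 * (Δ (fun q => v (-1) q 2)) 0 ≤ 0))) (hss : ∀ lam : ℝ, 0 < lam → IsDssAbout c lam v) : False := by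
  have hw : IsTypeIAncientMild C (fun t x => v t (x + c)) := (PoloidalWindowDoorPoloidalWindowRigidityWindow.isTypeIAncientMild_of_class hP.1 hP.2.1 hP.2.2.1 hP.2.2.2.1).comp_add_right c
  have hsc : ∀ lam : ℝ, 0 < lam → ∀ s < 0, ∀ y,
      lam • (fun t x => v t (x + c)) (lam ^ 2 * s) (lam • y) = (fun t x => v t (x + c)) s y :=
    fun lam hlam s hs y => ((isDss_translate_of_isDssAbout (hss lam hlam)) s hs y).symm
  have h0 := PoloidalWindowDoorPoloidalWindowRigidityStrata.eq_zero_of_scaleInvariant hw.2.2.2 hw.1.continuousOn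
    (fun s t hst ht x => hw.mild_eq_heatExtension hst ht x) hw.2.1 hsc
  have h1 : v (-1) 0 = 0 := by
    have := h0 (-1) (by norm_num) (-c)
    simpa using this
  exact hP.2.2.2.2.2.1 (by rw [h1]; rfl)


end Summit.NavierStokesRegularity.NavierStokesRegularity.Theorems.PoloidalWindowDoorPoloidalWindowRigidityNearOneFloor

end
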